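import Mathlib
import Summits.ValiantsHypothesis.ValiantsHypothesis.Theorems.NewtonUnitEquationsDissociatedUniformTotalsLaw
import HarnessLib

/-!
# Crux `NewtonUnitEquations.DissociatedUniform` (stmt-ValiantsHypothesis-5905): the GENERAL totals law of model (Q**), typed

Companion of `…DissociatedUniformTotalsLaw` (the `n = 3` law).  Memo `Cruxes/DissociatedUniform/NOTES-d1g3.md` §2 L1 / §3: the
union/Minkowski recursion bounds a CLASS of an `n`-coordinate (Q**) design by TOTALS of the two halves
(`V_s ≤ T_A + T_B`), so it loses a factor `|G|` per level and reproduces Theorem Q's quasi-polynomial shape UNLESS it is fed a totals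
law directly; the statement that does the work is the GENERAL totals law
`T(n) := ∑_s #vert conv {∑_j c_j x_j : ∑_j x_j = s} ≤ C · n · |G|²` (memo §3: data `T(n) ≈ (n-1)·t·q`, conjecturally
`≤ (n-1)·t·q + O_n(q)` with `t = q` letters).  Since a class is bounded by the total, the general law is AT ONCE the class-hull
vertex bound ("Conjecture K") on the whole (Q**) design stratum with a polynomial `C·n·|G|²` — no recursion needed — which by the
design dictionary (`ShadowVerticesDesign.classVertexWords_le_of_smallShadow` states the converse direction by name) is what
`stub_smallShadow` asserts on that stratum.

What is here: `TotalsLawN.classPts c s` / `classVert` / `totalVert` for `c : Fin n → G → ℝ²`; the conjecture-grade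
`@[conjecture] TotalsLawGeneral C : ∀ n G c, T ≤ C·(n+1)·|G|²` (OPEN, never asserted; `n + 1` so that `n = 0, 1` are not
vacuously false: `T(0) = 1`, `T(1) = |G|`); PROVED: the `n = 3` case is literally the three-curve class of the companion file
(`classPts_three`, `totalVert_three`), hence `TotalsLawGeneral C → TotalsLaw.TotalsLawThree (4C)`; the envelope
`V_s ≤ |G|^n`; and the per-class form `classVert ≤ T`.  Nothing about the law itself is claimed.
[folklore: extreme points of the hull of a finite set lie in the set]
-/

set_option linter.dupNamespace false -- `ValiantsHypothesis.ValiantsHypothesis` (summit = problem) in every name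

open scoped BigOperators

namespace Summit.ValiantsHypothesis.ValiantsHypothesis.Theorems.NewtonUnitEquationsDissociatedUniform

namespace TotalsLawN

variable {G : Type*} [AddCommGroup G] [Fintype G] {n : ℕ}

/-- The class `s` of an `n`-coordinate (Q**) design with curves `c j : G → ℝ²`: all points `∑_j c j (x j)` over words
`x : Fin n → G` with `∑_j x j = s`. -/
def classPts (c : Fin n → G → (Fin 2 → ℝ)) (s : G) : Set (Fin 2 → ℝ) :=
  Set.range fun x : {x : Fin n → G // ∑ j, x j = s} => ∑ j, c j (x.1 j)

/-- `V_s`: number of hull vertices of the class `s`. -/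
noncomputable def classVert (c : Fin n → G → (Fin 2 → ℝ)) (s : G) : ℕ :=
  (Set.extremePoints ℝ (convexHull ℝ (classPts c s))).ncard

/-- `T(n) = ∑_s V_s`. -/
noncomputable def totalVert (c : Fin n → G → (Fin 2 → ℝ)) : ℕ :=
  ∑ s, classVert c s

/-- **The general totals law of model (Q**)** (conjecture-grade, OPEN; memo NOTES-d1g3 §3, data `T(n) ≈ (n-1)·|G|²` for
`n ≤ 7`, `|G| ≤ 31`): for every `n`, every finite abelian `G` and all curves, `T(n) ≤ C · (n + 1) · |G|²`.  Not asserted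
anywhere. -/
@[conjecture] def TotalsLawGeneral (C : ℕ) : Prop :=
  ∀ (n : ℕ) (G : Type) [AddCommGroup G] [Fintype G] (c : Fin n → G → (Fin 2 → ℝ)),
    totalVert c ≤ C * (n + 1) * Fintype.card G ^ 2

/-! ### Envelope -/

/-- `V_s ≤ |G|^n` (a class has at most `|G|^n` words). [folklore] -/
theorem classVert_le_card_pow (c : Fin n → G → (Fin 2 → ℝ)) (s : G) : classVert c s ≤ Fintype.card G ^ n := by
  classical
  unfold classVert
  have hfin : (classPts c s).Finite := Set.finite_range _
  calc (Set.extremePoints ℝ (convexHull ℝ (classPts c s))).ncard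
      ≤ (classPts c s).ncard := Set.ncard_le_ncard extremePoints_convexHull_subset hfin
    _ ≤ Fintype.card {x : Fin n → G // ∑ j, x j = s} := TotalsLaw.ncard_range_le_card _
    _ ≤ Fintype.card (Fin n → G) := Fintype.card_subtype_le _
    _ = Fintype.card G ^ n := by rw [Fintype.card_fun, Fintype.card_fin]

/-- A class is bounded by the total: `V_s ≤ T`. [folklore] -/
theorem classVert_le_totalVert (c : Fin n → G → (Fin 2 → ℝ)) (s : G) : classVert c s ≤ totalVert c := by
  unfold totalVert
  exact Finset.single_le_sum (f := fun s => classVert c s) (fun _ _ => Nat.zero_le _) (Finset.mem_univ s)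

/-! ### The `n = 3` case is the three-curve class of the companion file -/

omit [Fintype G] in
/-- `classPts ![a, b, c] s = TotalsLaw.classPts a b c s`: the general class at `n = 3` is literally the three-curve class.
[folklore] -/
theorem classPts_three (a b c : G → (Fin 2 → ℝ)) (s : G) :
    classPts ![a, b, c] s = TotalsLaw.classPts a b c s := by
  ext p
  simp only [classPts, TotalsLaw.classPts, Set.mem_range, Prod.exists, Subtype.exists]
  constructor
  · rintro ⟨x, hx, rfl⟩
    refine ⟨x 0, x 1, ?_⟩
    rw [Fin.sum_univ_three] at hx
    have hz : s - x 0 - x 1 = x 2 := by rw [← hx]; abel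
    rw [Fin.sum_univ_three, hz]
    simp
  · rintro ⟨x, y, rfl⟩
    refine ⟨![x, y, s - x - y], ?_, ?_⟩
    · rw [Fin.sum_univ_three]
      simp only [Matrix.cons_val_zero, Matrix.cons_val_one, Matrix.cons_val]
      abel
    · rw [Fin.sum_univ_three]
      simp

/-- `T` at `n = 3` is the three-curve total `TotalsLaw.totalVert a b c`. [folklore] -/
theorem totalVert_three (a b c : G → (Fin 2 → ℝ)) : totalVert ![a, b, c] = TotalsLaw.totalVert a b c := by
  unfold totalVert classVert TotalsLaw.totalVert TotalsLaw.classVert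
  simp_rw [classPts_three]

/-- The general law implies the `n = 3` law with constant `4C`. -/
theorem totalsLawGeneral_imp_three (C : ℕ) (h : TotalsLawGeneral C) : TotalsLaw.TotalsLawThree (4 * C) := by
  intro G _ _ a b c
  have h3 := h 3 G ![a, b, c]
  rw [totalVert_three] at h3
  calc TotalsLaw.totalVert a b c ≤ C * (3 + 1) * Fintype.card G ^ 2 := h3
    _ = 4 * C * Fintype.card G ^ 2 := by ring

/-- **The general law is at once the class-hull vertex bound on the whole (Q**) stratum** (per class, polynomial
`C (n+1) |G|²`, no recursion; stated for label groups in `Type`, where the law is quantified). -/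
theorem classVert_le_of_totalsLawGeneral {C : ℕ} (h : TotalsLawGeneral C) {H : Type} [AddCommGroup H] [Fintype H]
    (c : Fin n → H → (Fin 2 → ℝ)) (s : H) : classVert c s ≤ C * (n + 1) * Fintype.card H ^ 2 :=
  (classVert_le_totalVert c s).trans (h n H c)

end TotalsLawN

end Summit.ValiantsHypothesis.ValiantsHypothesis.Theorems.NewtonUnitEquationsDissociatedUniform
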